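import Literature.Geometry.Lorentzian.KerrDeSitterData
import Literature.Geometry.Lorentzian.KerrDeSitterCoord
import Literature.Geometry.Lorentzian.KerrDeSitterLorentzian
import Literature.Geometry.Lorentzian.SecondFundamentalFormSymm
import Literature.Geometry.Lorentzian.MeanCurvatureRegularity
import Literature.Geometry.Lorentzian.LeviCivitaProofs
import Literature.Geometry.Lorentzian.ChartCalculus
import Mathlib.Analysis.Calculus.ContDiff.FiniteDimension
import HarnessLib

/-!
# Discharge of `KerrDeSitter.SliceFacts`: the Kerr–de Sitter slice data need no standing hypothesis

`KerrDeSitterData.lean` bundles as the `Prop`-class `KerrDeSitter.SliceFacts` (instance hypothesis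
of `KerrDeSitter.data`) three named facts about the horizon-crossing slice
`{t* = 0} ∩ {r > max r₀ 0}` of the Kerr–de Sitter star chart, on top of the `Prop`-class
`KerrDeSitter.Facts` of `KerrDeSitter.lean` (analyticity, Lorentzian signature and the identity
`g(T, ·) = −dt*` of the chart components). After `KerrDeSitterLorentzian.lean`
(`isLorentzian_bilin_holds`), `KerrDeSitterData.lean` (`bilin_timeVector_holds`) and
`KerrDeSitterCoord.lean` (`contMDiff_bilin_holds`, `contMDiff_timeVector_holds`) every field of
`KerrDeSitter.Facts` is a theorem; this file proves the two remaining fields of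
`KerrDeSitter.SliceFacts` and assembles both classes, following the `Λ = 0` twin
`KerrSliceFacts.lean` line by line:

* `KerrDeSitter.facts_holds : KerrDeSitter.Facts` (assembly of the four discharged fields);
* `KerrDeSitter.contMDiff_sliceNormal_lift` — for regular parameters the future unit normal
  `ν = (T⁰)^{-1/2} T` of the slice has a `C^∞` lift `y ↦ ((0, y), ν y) ∈ T(Kerr.region a r₀)`
  along the slice embedding (the components are analytic functions of `y` on the chart domain,
  Hintz–Vasy 2018, Prop. 3.5 and §3.5, through `KerrDeSitter.contDiffAt_timeVector`);
* `KerrDeSitter.sliceK_symm_holds` — **discharge of `KerrDeSitter.sliceK_symm`**: the second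
  fundamental form of the slice is symmetric (O'Neill 1983, Ch. 4, Lemma 4.4, through the tree's
  `secondFundamentalForm_symm_holds`);
* `KerrDeSitter.contMDiff_sliceK_holds` — **discharge of `KerrDeSitter.contMDiff_sliceK`**:
  `y ↦ k_y` is a smooth section of the bundle of bilinear forms (O'Neill 1983, Ch. 4, Lemma 4:
  the shape tensor is a smooth tensor field; through `contMDiffAt_secondFundamentalForm_apply` for
  the components and `OpensChart.contMDiffAt_bilinSection_iff` + `contDiffOn_clm_apply`);
* `KerrDeSitter.sliceFacts_holds : KerrDeSitter.SliceFacts` (under the — now dischargeable —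
  instance hypothesis `[KerrDeSitter.Facts]` that the class itself carries), so that users of
  `KerrDeSitter.data M a Λ r₀ h` may write `haveI := KerrDeSitter.facts_holds` and
  `haveI := KerrDeSitter.sliceFacts_holds` and keep no hypothesis beyond `h : IsRegular M a Λ r₀`.
  No global instances are declared here (theorems only).

## References

* B. O'Neill, *Semi-Riemannian geometry with applications to relativity*, Academic Press 1983,
  Ch. 4, Lemma 4 (p. 100) and Lemma 4.4.
* P. Hintz, A. Vasy, *The global non-linear stability of the Kerr–de Sitter family of black
  holes*, Acta Math. 220 (2018) 1–206, §3.2 (3.14), Prop. 3.5, §3.5.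
* O. L. Petersen, A. Vasy, *Analyticity of quasinormal modes in the Kerr and Kerr–de Sitter
  spacetimes*, arXiv:2112.01355, §1.1 and Remark 1.1.
-/

noncomputable section

open Bundle TopologicalSpace Manifold Set
open scoped ContDiff Topology

namespace Literature.Geometry.Lorentzian

namespace KerrDeSitter

/-! ### `KerrDeSitter.Facts` holds -/

/-- **`KerrDeSitter.Facts` holds**: every field is a theorem (`contMDiff_bilin_holds`,
`isLorentzian_bilin_holds`, `bilin_timeVector_holds`, `contMDiff_timeVector_holds`). Hintz–Vasy
2018, §3.2 (3.14) and Prop. 3.5; Petersen–Vasy arXiv:2112.01355, §1.1.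
[cite: HintzVasy2018, §3.2 (3.14) and Prop. 3.5] -/
theorem facts_holds : KerrDeSitter.Facts where
  contMDiff_bilin := contMDiff_bilin_holds
  isLorentzian_bilin := isLorentzian_bilin_holds
  bilin_timeVector := bilin_timeVector_holds
  contMDiff_timeVector := contMDiff_timeVector_holds

/-! ### The unit normal has a smooth lift -/

/-- The coordinate representative of the slice normal, `N(y) = (T⁰(0, y))^{-1/2} T(0, y)`, is
`C^n` at every `y` with `(0, y)` in the chart domain, for regular parameters (then `T⁰ > 0`,
`timeVector_apply_zero_pos`, and `T` is analytic there, `contDiffAt_timeVector`). Hintz–Vasy 2018,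
Prop. 3.5 and §3.5. [cite: HintzVasy2018, Prop. 3.5] -/
theorem contDiffAt_sliceNormalRep {M a Λ r₀ : ℝ} (h : IsRegular M a Λ r₀) {y : E3}
    (hy : E4.ofTimeSpace 0 y ∈ Kerr.region a r₀) {n : WithTop ℕ∞} :
    ContDiffAt ℝ n (fun y : E3 ↦ (√(timeVector M a Λ (E4.ofTimeSpace 0 y) 0))⁻¹ •
      timeVector M a Λ (E4.ofTimeSpace 0 y)) y := by
  have hO : ContDiff ℝ n (E4.ofTimeSpace 0) :=
    contMDiff_iff_contDiff.mp (E4.contMDiff_ofTimeSpace 0 n)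
  have hx : 0 < Kerr.radius a (E4.ofTimeSpace 0 y) := Kerr.radius_pos_of_mem_region hy
  have hT : ContDiffAt ℝ n (fun y : E3 ↦ timeVector M a Λ (E4.ofTimeSpace 0 y)) y :=
    (contDiffAt_timeVector M a h.lambda_nonneg hx (h.tiltNormSq_pos hy)).comp y hO.contDiffAt
  have hT0 : ContDiffAt ℝ n (fun y : E3 ↦ timeVector M a Λ (E4.ofTimeSpace 0 y) 0) y :=
    contDiffAt_euclidean.1 hT 0
  have hpos : 0 < timeVector M a Λ (E4.ofTimeSpace 0 y) 0 := timeVector_apply_zero_pos h hy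
  have hS : ContDiffAt ℝ n (fun y : E3 ↦ (√(timeVector M a Λ (E4.ofTimeSpace 0 y) 0))⁻¹) y :=
    (hT0.sqrt hpos.ne').inv (Real.sqrt_pos.2 hpos).ne'
  exact hS.smul hT

/-- **The future unit normal of the Kerr–de Sitter slice has a `C^∞` lift** along the slice
embedding: `y ↦ ((0, y), ν y)` is a smooth map `Kerr.slice a r₀ → T(Kerr.region a r₀)`, for
regular parameters. In the identity trivialisation of `T(Kerr.region a r₀)`
(`OpensChart.trivializationAt_apply`) this is the smoothness of the base map `y ↦ (0, y)` and of
the representative `(T⁰)^{-1/2} T` (`contDiffAt_sliceNormalRep`). Hintz–Vasy 2018, §3.5 (the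
future unit normal of `Σ₀`). [cite: HintzVasy2018, §3.5] -/
theorem contMDiff_sliceNormal_lift {M a Λ r₀ : ℝ} (h : IsRegular M a Λ r₀) :
    ContMDiff 𝓘(ℝ, E3) 𝓘(ℝ, E4).tangent ∞
      (fun y : Kerr.slice a r₀ ↦
        (TotalSpace.mk' E4 (Kerr.sliceEmbed a r₀ y) (sliceNormal M a Λ r₀ y) :
          TangentBundle 𝓘(ℝ, E4) (Kerr.region a r₀))) := by
  intro y
  rw [ModelWithCorners.tangent, contMDiffAt_totalSpace]
  refine ⟨Kerr.contMDiff_sliceEmbed a r₀ ∞ y, ?_⟩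
  have hrep : (fun x : Kerr.slice a r₀ ↦ (trivializationAt E4 (TangentSpace 𝓘(ℝ, E4))
      (Kerr.sliceEmbed a r₀ y) (TotalSpace.mk' E4 (Kerr.sliceEmbed a r₀ x)
        (sliceNormal M a Λ r₀ x) : TangentBundle 𝓘(ℝ, E4) (Kerr.region a r₀))).2) =
      fun x : Kerr.slice a r₀ ↦ ((√(timeVector M a Λ (E4.ofTimeSpace 0 (x : E3)) 0))⁻¹ •
        timeVector M a Λ (E4.ofTimeSpace 0 (x : E3)) : E4) := by
    funext x
    exact (congrArg Prod.snd (OpensChart.trivializationAt_apply (Kerr.sliceEmbed a r₀ y)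
      (Kerr.sliceEmbed a r₀ x) (sliceNormal M a Λ r₀ x))).trans rfl
  rw [hrep]
  exact (OpensChart.contMDiffAt_iff y _
    (fun y : E3 ↦ (√(timeVector M a Λ (E4.ofTimeSpace 0 y) 0))⁻¹ •
      timeVector M a Λ (E4.ofTimeSpace 0 y)) (fun _ ↦ rfl)).mpr
    (contDiffAt_sliceNormalRep h (Kerr.mem_slice_iff_ofTimeSpace_mem_region.1 y.2))

/-! ### Symmetry of `k` -/

/-- **Discharge of the named fact `KerrDeSitter.sliceK_symm`** (field of
`KerrDeSitter.SliceFacts`): for regular parameters the second fundamental form of the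
Kerr–de Sitter slice is symmetric — the slice embedding is `C^∞` (`Kerr.contMDiff_sliceEmbed`),
the normal `ν` is a genuine normal field (`isFutureUnitNormal_sliceNormal`) with `C^∞` lift
(`contMDiff_sliceNormal_lift`), and every point of the open slice is interior, so the tree's
`secondFundamentalForm_symm_holds` applies. O'Neill 1983, Ch. 4, Lemma 4.4; Wald 1984, §10.2.
[cite: ONeill1983, Ch. 4, Lemma 4.4] -/
theorem sliceK_symm_holds : ∀ [Facts] (M a Λ r₀ : ℝ), sliceK_symm M a Λ r₀ := by
  intro _ M a Λ r₀ h _ y v w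
  have hsymm := PseudoRiemannianMetric.secondFundamentalForm_symm_holds
    (g := (smoothMetric M a Λ r₀ h).toPseudoRiemannianMetric) (I' := 𝓘(ℝ, E3))
    (N := Kerr.slice a r₀) (Kerr.contMDiff_sliceEmbed a r₀ 2)
    (isFutureUnitNormal_sliceNormal M a Λ r₀ h).1.isNormalTo
    ((contMDiff_sliceNormal_lift h).of_le (by exact_mod_cast le_top)) (y := y)
    BoundarylessManifold.isInteriorPoint
  rw [sliceK_apply, sliceK_apply]
  exact hsymm.eq v w

/-! ### Smoothness of `k` -/

/-- The components `y ↦ k_y(v, w)` of the second fundamental form of the Kerr–de Sitter slice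
against constant vectors are `C^∞` functions on the slice (`contMDiffAt_secondFundamentalForm_apply`
with the smooth slice embedding, the smooth lift of `ν` and constant — hence smooth — vector
fields). O'Neill 1983, Ch. 4, Lemma 4 (the shape tensor is a smooth tensor field).
[cite: ONeill1983, Ch. 4, Lemma 4] -/
theorem contMDiffAt_sliceK_apply [Facts] {M a Λ r₀ : ℝ} (h : IsRegular M a Λ r₀)
    [(smoothMetric M a Λ r₀ h).HasLeviCivita] (v w : E3) (y : Kerr.slice a r₀) :
    ContMDiffAt 𝓘(ℝ, E3) 𝓘(ℝ, ℝ) ∞ (fun y : Kerr.slice a r₀ ↦ sliceK M a Λ r₀ h y v w) y := by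
  have hV := fun u : E3 ↦ (OpensChart.contMDiffAt_section_iff (n := ∞) y
    (fun x : Kerr.slice a r₀ ↦ (u : TangentSpace 𝓘(ℝ, E3) x))).mpr contMDiffAt_const
  have hk := PseudoRiemannianMetric.contMDiffAt_secondFundamentalForm_apply
    (g := (smoothMetric M a Λ r₀ h).toPseudoRiemannianMetric) (I' := 𝓘(ℝ, E3))
    (Kerr.contMDiff_sliceEmbed a r₀ ∞) (contMDiff_sliceNormal_lift h)
    (V := fun _ : Kerr.slice a r₀ ↦ v) (W := fun _ : Kerr.slice a r₀ ↦ w) (y₀ := y) (hV v) (hV w)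
  simpa only [sliceK_apply] using hk

/-- **Discharge of the named fact `KerrDeSitter.contMDiff_sliceK`** (field of
`KerrDeSitter.SliceFacts`): for regular parameters `y ↦ k_y` is a `C^∞` section of the bundle of
bilinear forms on `T(Kerr.slice a r₀)`. By `OpensChart.contMDiffAt_bilinSection_iff` this is
ordinary smoothness of the representative `y ↦ k_y : E3 → (E3 →L E3 →L ℝ)` (extended by `0` off
the slice), which by `contDiffOn_clm_apply` (finite-dimensional source) reduces to the smoothness
of the components `y ↦ k_y(v, w)` (`contMDiffAt_sliceK_apply`). O'Neill 1983, Ch. 4, Lemma 4;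
Hintz–Vasy 2018, Prop. 3.5 and §3.5. [cite: ONeill1983, Ch. 4, Lemma 4] -/
theorem contMDiff_sliceK_holds : ∀ [Facts] (M a Λ r₀ : ℝ), contMDiff_sliceK M a Λ r₀ := by
  classical
  intro _ M a Λ r₀ h _ y
  -- the representative, extended by zero off the (open) slice
  set G : E3 → E3 →L[ℝ] E3 →L[ℝ] ℝ :=
    fun z ↦ if hz : z ∈ Kerr.slice a r₀ then sliceK M a Λ r₀ h ⟨z, hz⟩ else 0 with hG
  have hrep : ∀ z : Kerr.slice a r₀, sliceK M a Λ r₀ h z = G z := fun z ↦ by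
    rw [hG]
    simp only [SetLike.coe_mem, ↓reduceDIte]
  rw [OpensChart.contMDiffAt_bilinSection_iff y _ G hrep]
  -- smoothness on the open slice, componentwise
  have hopen : IsOpen (Kerr.slice a r₀ : Set E3) := (Kerr.slice a r₀).isOpen
  suffices hOn : ContDiffOn ℝ ∞ G (Kerr.slice a r₀ : Set E3) from
    hOn.contDiffAt (hopen.mem_nhds y.2)
  refine contDiffOn_clm_apply.mpr fun v ↦ contDiffOn_clm_apply.mpr fun w ↦ ?_
  intro z hz
  refine ContDiffAt.contDiffWithinAt ?_
  have hz' := contMDiffAt_sliceK_apply h v w ⟨z, hz⟩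
  exact (OpensChart.contMDiffAt_iff (⟨z, hz⟩ : Kerr.slice a r₀)
    (fun u : Kerr.slice a r₀ ↦ sliceK M a Λ r₀ h u v w) (fun z ↦ G z v w)
    (fun u ↦ congrArg (fun B : E3 →L[ℝ] E3 →L[ℝ] ℝ ↦ B v w) (hrep u))).mp hz'

/-! ### The instance -/

/-- **`KerrDeSitter.SliceFacts` holds** (under the class's own instance hypothesis
`[KerrDeSitter.Facts]`, itself the theorem `facts_holds`): every field is a theorem
(`PseudoRiemannianMetric.isCovariantDerivativeOn_leviCivitaFun_holds`, `sliceK_symm_holds`,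
`contMDiff_sliceK_holds`). O'Neill 1983, Ch. 3, Thm. 3.11 and Ch. 4, Lemma 4.4; Hintz–Vasy 2018,
§3.5. [cite: ONeill1983, Ch. 4, Lemma 4.4] -/
theorem sliceFacts_holds [Facts] : KerrDeSitter.SliceFacts where
  isCovariantDerivativeOn_leviCivitaFun _ _ _ _ _ :=
    PseudoRiemannianMetric.isCovariantDerivativeOn_leviCivitaFun_holds
  sliceK_symm := sliceK_symm_holds
  contMDiff_sliceK := contMDiff_sliceK_holds

end KerrDeSitter

end Literature.Geometry.Lorentzian

end
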